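import Mathlib
import Summits.KontsevichZagierPeriods.Zeta5Search.CatalanTwoAdicTransfer
import Summits.KontsevichZagierPeriods.Zeta5Search.Denom.CatalanQBridgeProof
import Summits.KontsevichZagierPeriods.Zeta5Search.PadicMeasureCriterion
import HarnessLib

/-!
# Catalan box family — the 2-adic RAY chain assembled in the kernel, modulo three named hypotheses

HONEST FRAMING: systematic search; no irrationality claim unless certified. This file makes NO unconditional
claim about `ξ`: it proves that the 2-adic irrationality MEASURE of `ξ = (1/8)Σ 4^{μ+1}/((2μ+1)²C(2μ,μ)) ∈ ℚ₂`
is at most `4W log 2/(τ − h_g)` (any `τ' > 4W log 2` in place of `4W log 2`) GIVEN (i) the transfer law `TwoAdicTransfer` (K5a; paper-proved, conjecture node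
of `CatalanTwoAdicTransfer.lean`), (ii) `RayIntegrality j` (the cleared `P`-parts are integers: sharp odd envelope
`d*_{(j+1)n} d*_{jn}` = CATK6 of fam-denom, paper-proved for `j ≥ 4` — the `Q`-parts are PROVED integral here from `TwoAdicLaw`/`DyadicLaw`) and
(iii) `RayGrowth j h_g n₀` (archimedean growth of the cleared forms; growth rates b_j lane-certified by two exact
routes for j = 5, 6, 8, 10, 12 and by one for j = 16; reducible to the explicit `Λ_n Q_n`, `Λ_n` — see the sequel).
Everything else — the exact 2-adic size `‖form_n‖₂ = 2^{−(4Wn+2)+s₂(jn)+s₂((j+1)n)}` (from `norm_J2`), its two-sided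
exponential bounds, and the measure criterion `measure_of_two_sided_forms` — is kernel-checked here.
INTRINSIC FORM (gen 2): `ray_measure_intrinsic` is the same chain for ANY rational sequence `P n` satisfying the
2-ADIC identity `J2 = P n + ξ·Q_n`, `Λ_n·P n ∈ ℤ` and the growth bound — no `Jsym`, no `G`, no transfer law — and
`ray_measure` is its corollary under (i)–(iii).  It is the form a successor closes UNCONDITIONALLY with fam-denom's
closed form `rayPClosed j n`: a finite partial-fraction identity summed in `ℚ₂` (TWOADIC §8 (1)–(2)), their
`rayPClosed_isInt` (`j ≥ 4`), and an elementary size bound; the real period then leaves the critical path.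
Numerically (families/catalan/TWOADIC.md §11.3), ray j = 8 (W = 17): h_g = b₈ + 2W log 2 + W ≈ 43.71 < τ < 4W log 2
= 47.13 gives μ₂(ξ) ≤ 13.76 (+o(1)); the Calegari–Beukers value 7.18 is NOT reached by any ray (F16).

Sequel `CatalanTwoAdicRayGrowth.lean`: the growth of the `P`-part is automatic (|J_n| ≤ 1), and the same
assembly for arbitrary odd window multipliers (`window_measure`).
-/

namespace Summit.KontsevichZagierPeriods.Zeta5Search.CatalanTwoAdicSeries

open Real Finset
open Literature.NumberTheory.Irrationality.Nesterenko2016 (Jsym)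
open Literature.NumberTheory.Transcendental (catalanConstant)
open Summit.KontsevichZagierPeriods.Zeta5Search.CatalanQSum (catalanQ)
open Summit.KontsevichZagierPeriods.Zeta5Search.PadicIrrationality (measure_of_two_sided_forms)

/-- The odd part of `lcm(1,…,N)`: `d*_N = ∏_{odd primes p ≤ N} p^{⌊log_p N⌋}`. -/
def dstarOdd (N : ℕ) : ℕ := ∏ p ∈ (range (N + 1)).filter (fun p => p.Prime ∧ p ≠ 2), p ^ Nat.log p N

/-- `dstarOdd N > 0`. -/
theorem dstarOdd_pos (N : ℕ) : 0 < dstarOdd N := by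
  unfold dstarOdd
  exact prod_pos fun p hp => pow_pos (Nat.Prime.pos (mem_filter.mp hp).2.1) _

/-- `dstarOdd N` is odd (coprime to 2). -/
theorem coprime_two_dstarOdd (N : ℕ) : Nat.Coprime 2 (dstarOdd N) := by
  unfold dstarOdd
  refine Nat.Coprime.prod_right fun p hp => ?_
  have hp' := (mem_filter.mp hp).2
  exact ((Nat.coprime_primes Nat.prime_two hp'.1).mpr (Ne.symm hp'.2)).pow_right _

/-- The ray coefficient `Q_n = catalanQ(n, jn, n, (j+1)n, n)`. -/
def rayQ (j n : ℕ) : ℚ := catalanQ n (j * n) n ((j + 1) * n) n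

/-- The ray multiplier `Λ_n = d*_{(j+1)n} · d*_{jn} · 2^{2Wn}`, `W = 2j+1`. -/
def rayMult (j n : ℕ) : ℚ := ((dstarOdd ((j + 1) * n) * dstarOdd (j * n) : ℕ) : ℚ) * 2 ^ (2 * (2 * j + 1) * n)

/-- The ray multiplier `rayMult j n` is nonzero. -/
theorem rayMult_ne_zero (j n : ℕ) : rayMult j n ≠ 0 := by
  unfold rayMult
  refine mul_ne_zero ?_ (pow_ne_zero _ two_ne_zero)
  exact_mod_cast (Nat.mul_pos (dstarOdd_pos _) (dstarOdd_pos _)).ne'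

/-- The 2-adic valuation of `rayMult j n` (its power of 2). -/
theorem padicValRat_two_rayMult (j n : ℕ) : padicValRat 2 (rayMult j n) = (2 * (2 * j + 1) * n : ℕ) := by
  unfold rayMult
  have hc : Nat.Coprime 2 (dstarOdd ((j + 1) * n) * dstarOdd (j * n)) :=
    Nat.Coprime.mul_right (coprime_two_dstarOdd _) (coprime_two_dstarOdd _)
  have hodd : ¬ 2 ∣ dstarOdd ((j + 1) * n) * dstarOdd (j * n) := fun hd => by
    have := Nat.Coprime.eq_one_of_dvd hc hd; omega
  have hne : (((dstarOdd ((j + 1) * n) * dstarOdd (j * n) : ℕ)) : ℚ) ≠ 0 := by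
    exact_mod_cast (Nat.mul_pos (dstarOdd_pos _) (dstarOdd_pos _)).ne'
  rw [padicValRat.mul hne (pow_ne_zero _ two_ne_zero), padicValRat.pow (2 : ℚ),
    padicValRat.of_nat, padicValNat.eq_zero_of_not_dvd hodd]
  have h2 : padicValRat 2 (2 : ℚ) = 1 := by simpa using padicValRat.self (p := 2) one_lt_two
  rw [h2]; push_cast; ring

/-- A rational whose reduced denominator is a power of `2` and whose `2`-adic valuation is `≥ 0` is an integer. -/
theorem den_eq_one_of_dyadic {q : ℚ} {e : ℕ} (hden : q.den = 2 ^ e) (hv : 0 ≤ padicValRat 2 q) :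
    q.den = 1 := by
  by_contra hne
  have he : e ≠ 0 := by
    rintro rfl
    exact hne (by simpa using hden)
  have h2den : 2 ∣ q.den := by rw [hden]; exact dvd_pow_self 2 he
  have hnum_odd : ¬ 2 ∣ q.num.natAbs := fun h => by
    have hg : 2 ∣ Nat.gcd q.num.natAbs q.den := Nat.dvd_gcd h h2den
    rw [q.reduced] at hg
    omega
  have hval : padicValRat 2 q = -(e : ℤ) := by
    simp only [padicValRat, padicValInt, padicValNat.eq_zero_of_not_dvd hnum_odd, hden,
      padicValNat.prime_pow]
    simp
  rw [hval] at hv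
  have : (0 : ℤ) < e := by exact_mod_cast Nat.pos_of_ne_zero he
  linarith

open Summit.KontsevichZagierPeriods.Zeta5Search.CatalanQSum (twoAdicLaw_holds) in
open Summit.KontsevichZagierPeriods.Zeta5Search.Denom.CatalanBox (dyadicLaw_holds) in
/-- The `Q` half of integrality is a THEOREM: `d*_{(j+1)n} d*_{jn} 2^{2Wn} · Q_n ∈ ℤ` (from `TwoAdicLaw` + `DyadicLaw`,
both proved in the tree: p238507, p239076). -/
theorem rayMult_mul_rayQ_isInt {j n : ℕ} (hj : 1 ≤ j) (hn : 1 ≤ n) :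
    ∃ z : ℤ, (z : ℚ) = rayMult j n * rayQ j n := by
  have h1 : n ≤ n + (j + 1) * n := by omega
  have h2 : j * n ≤ (j + 1) * n + n := by nlinarith
  have h3 : n ≤ n + n := by omega
  have h4 : (j + 1) * n ≤ n + j * n := by nlinarith
  have h5 : n + 1 ≤ j * n + n := by
    have : 1 ≤ j * n := Nat.one_le_iff_ne_zero.mpr (Nat.mul_ne_zero (by omega) (by omega))
    omega
  obtain ⟨e, he⟩ := dyadicLaw_holds n (j * n) n ((j + 1) * n) n h1 h2 h3 h4 h5
  have hlaw := twoAdicLaw_holds n (j * n) n ((j + 1) * n) n h1 h2 h3 h4 h5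
  by_cases hQ : rayQ j n = 0
  · exact ⟨0, by simp [hQ]⟩
  have hQ' : catalanQ n (j * n) n ((j + 1) * n) n ≠ 0 := hQ
  set q : ℚ := rayMult j n * rayQ j n with hq
  have hMnat : rayMult j n = ((dstarOdd ((j + 1) * n) * dstarOdd (j * n) * 2 ^ (2 * (2 * j + 1) * n) : ℕ) : ℚ) := by
    unfold rayMult; push_cast; ring
  have hMden : (rayMult j n).den = 1 := by
    rw [hMnat, show (((dstarOdd ((j + 1) * n) * dstarOdd (j * n) * 2 ^ (2 * (2 * j + 1) * n) : ℕ)) : ℚ)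
      = (((dstarOdd ((j + 1) * n) * dstarOdd (j * n) * 2 ^ (2 * (2 * j + 1) * n) : ℕ) : ℤ) : ℚ) by push_cast; ring]
    exact Rat.den_intCast _
  have hdvd : q.den ∣ 2 ^ e := by
    have := Rat.mul_den_dvd (rayMult j n) (rayQ j n)
    rw [hMden, one_mul] at this
    unfold rayQ at this; rwa [he] at this
  obtain ⟨e', -, he'⟩ := (Nat.dvd_prime_pow Nat.prime_two).mp hdvd
  have hv : 0 ≤ padicValRat 2 q := by
    rw [hq, padicValRat.mul (rayMult_ne_zero j n) hQ, padicValRat_two_rayMult]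
    unfold rayQ; rw [hlaw]
    have e1 : j * n + n - n = j * n := by omega
    have e2 : n + (j + 1) * n - n = (j + 1) * n := by omega
    rw [e1, e2]
    have hs1 : (0 : ℤ) ≤ ((Nat.digits 2 (j * n)).sum : ℤ) := by positivity
    have hs2 : (0 : ℤ) ≤ ((Nat.digits 2 ((j + 1) * n)).sum : ℤ) := by positivity
    have hring : ((2 * (2 * j + 1) * n : ℕ) : ℤ)
        + (3 - 2 * (((j * n : ℕ) : ℤ) + (((j + 1) * n : ℕ) : ℤ)) + ((Nat.digits 2 (j * n)).sum : ℤ)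
            + ((Nat.digits 2 ((j + 1) * n)).sum : ℤ))
        = 3 + ((Nat.digits 2 (j * n)).sum : ℤ) + ((Nat.digits 2 ((j + 1) * n)).sum : ℤ) := by
      push_cast; ring
    rw [hring]; positivity
  have hden1 := den_eq_one_of_dyadic he' hv
  exact ⟨q.num, (Rat.den_eq_one_iff q).mp hden1⟩

/-- HYPOTHESIS SCHEMA (ii) — fam-denom's [CATK6]: the `P`-part of the ray form clears to an integer with the SHARP
envelope, `d*_{(j+1)n} d*_{jn} · 2^{2Wn} · P_n ∈ ℤ`.  SCOPE: paper-proved by fam-denom for `j ≥ 4`, `n ≥ 1` (and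
kernel-proved for their explicit closed form, `Denom.CatalanRayPClosed.rayPClosed_isInt`, modulo the identification
`P_n = rayPClosed j n`); for `j ≤ 3` the sharp odd envelope is LARGER (`j = 3`: `d*_{4n}·d*_{4n−1}`, CATK6 §5) and this
node AS TYPED is expected to FAIL there — it is only ever a HYPOTHESIS below, meant for `j ≥ 4`.
(The `Q` half is the theorem `rayMult_mul_rayQ_isInt` above, valid for all `j ≥ 1`.) -/
@[conjecture] def RayIntegrality (j : ℕ) : Prop :=
  ∀ n : ℕ, 1 ≤ n → ∀ P : ℚ, Jsym n (j * n) n ((j + 1) * n) n = (rayQ j n : ℝ) * catalanConstant + (P : ℝ) →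
    ∃ z : ℤ, (z : ℚ) = rayMult j n * P

/-- HYPOTHESIS SCHEMA (iii): archimedean growth of the cleared forms, `|Λ_n Q_n| + |Λ_n P_n| ≤ e^{h_g n}` for
`n ≥ n₀` (on the rays: `h_g = b_j + 2W log 2 + W + ε`, `b_j = (j+1)log(j+1) − j log j` certified by the zeta5-calc
lane for `j = 5, 6, 8`). -/
@[conjecture] def RayGrowth (j : ℕ) (hg : ℝ) (n₀ : ℕ) : Prop :=
  ∀ n : ℕ, n₀ ≤ n → ∀ P : ℚ, Jsym n (j * n) n ((j + 1) * n) n = (rayQ j n : ℝ) * catalanConstant + (P : ℝ) →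
    ((|rayMult j n * rayQ j n| + |rayMult j n * P| : ℚ) : ℝ) ≤ exp (hg * n)

/-- Binary digit sums are small: `2^{s₂(m)} ≤ 2m` for `m ≥ 1`. -/
theorem two_pow_digitSum_le (m : ℕ) (hm : m ≠ 0) : 2 ^ (Nat.digits 2 m).sum ≤ 2 * m := by
  have hlen : (Nat.digits 2 m).length = Nat.log 2 m + 1 := Nat.length_digits 2 m one_lt_two hm
  have hsum : (Nat.digits 2 m).sum ≤ (Nat.digits 2 m).length • 1 :=
    List.sum_le_card_nsmul _ _ fun d hd => Nat.lt_succ_iff.mp (Nat.digits_lt_base one_lt_two hd)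
  rw [smul_eq_mul, mul_one, hlen] at hsum
  calc 2 ^ (Nat.digits 2 m).sum ≤ 2 ^ (Nat.log 2 m + 1) := Nat.pow_le_pow_right two_pos hsum
    _ = 2 * 2 ^ Nat.log 2 m := by ring
    _ ≤ 2 * m := Nat.mul_le_mul_left _ (Nat.pow_log_le_self 2 hm)

/-- The exponent of the exact 2-adic size of the cleared ray form: `E_n = 4Wn + 2 − s₂(jn) − s₂((j+1)n)`. -/
theorem rayExponent_eq (j n : ℕ) :
    ((2 * (2 * j + 1) * n : ℕ) : ℤ) + v0 (j * n) ((j + 1) * n)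
      = 4 * (2 * j + 1) * n + 2 - ((Nat.digits 2 (j * n)).sum : ℤ) - ((Nat.digits 2 ((j + 1) * n)).sum : ℤ) := by
  unfold v0; push_cast; ring

/-- **The ray chain, INTRINSIC form — no real period, no transfer law.**  For ANY sequence of rationals `P n`
such that, for `n ≥ 1`, (a) the 2-ADIC identity `J2(n, jn, n, (j+1)n, n) = P n + ξ·Q_n` holds in `ℚ₂` (`Q_n = rayQ j n`),
(b) `Λ_n · P n ∈ ℤ`, and (c) `|Λ_n Q_n| + |Λ_n P n| ≤ e^{h_g n}` for `n ≥ n₀`: every `τ ∈ (h_g, 4W log 2)` and every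
`τ' > 4W log 2` give `‖ξ − u/v‖₂ ≥ C · max(|u|,v)^{−τ'/(τ − h_g)}` for ALL rationals.  (With `P n :=` fam-denom's closed
form `rayPClosed j n` the three inputs are: a finite partial-fraction identity summed in `ℚ₂`, their `rayPClosed_isInt`,
and an elementary size bound — none of them mentions `Jsym`, `G` or the transfer law.) -/
theorem ray_measure_intrinsic {j : ℕ} (hj : 1 ≤ j) (P : ℕ → ℚ)
    (hA2 : ∀ n : ℕ, 1 ≤ n →
      J2 n (j * n) n ((j + 1) * n) n = ((P n : ℚ) : ℚ_[2]) + xi * ((rayQ j n : ℚ) : ℚ_[2]))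
    (hIP : ∀ n : ℕ, 1 ≤ n → ∃ z : ℤ, (z : ℚ) = rayMult j n * P n)
    {hg : ℝ} {n₀ : ℕ}
    (hGP : ∀ n : ℕ, n₀ ≤ n → ((|rayMult j n * rayQ j n| + |rayMult j n * P n| : ℚ) : ℝ) ≤ exp (hg * n))
    (hg0 : 0 ≤ hg) {τ τ' : ℝ} (hτ1 : hg < τ)
    (hτ2 : τ < 4 * (2 * j + 1) * log 2) (hτ' : 4 * (2 * j + 1) * log 2 < τ') :
    ∃ n₁ : ℕ, ∀ r : ℚ,
      exp (-(τ' * (n₁ + 1))) * (max (r.num.natAbs : ℝ) r.den) ^ (-(τ' / (τ - hg)))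
        ≤ ‖xi - ((r : ℚ) : ℚ_[2])‖ := by
  -- abbreviations
  set W : ℕ := 2 * j + 1 with hW
  have hW1 : (1 : ℝ) ≤ W := by rw [hW]; push_cast; linarith [(show (1:ℝ) ≤ j by exact_mod_cast hj)]
  -- integer witnesses
  have hA : ∀ n : ℕ, ∃ z : ℤ, 1 ≤ n → (z : ℚ) = rayMult j n * rayQ j n := by
    intro n
    by_cases hn : 1 ≤ n
    · obtain ⟨z, hz⟩ := rayMult_mul_rayQ_isInt hj hn; exact ⟨z, fun _ => hz⟩
    · exact ⟨0, fun h => absurd h hn⟩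
  have hB : ∀ n : ℕ, ∃ z : ℤ, 1 ≤ n → (z : ℚ) = rayMult j n * P n := by
    intro n
    by_cases hn : 1 ≤ n
    · obtain ⟨z, hz⟩ := hIP n hn; exact ⟨z, fun _ => hz⟩
    · exact ⟨0, fun h => absurd h hn⟩
  choose a ha using hA
  choose b hb using hB
  -- the form equals Λ_n · J2_n in ℚ₂, hence its exact norm
  have hform : ∀ n : ℕ, 1 ≤ n →
      (a n : ℚ_[2]) * xi + b n = ((rayMult j n : ℚ) : ℚ_[2]) * J2 n (j * n) n ((j + 1) * n) n := by
    intro n hn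
    have e1 : (a n : ℚ_[2]) = ((rayMult j n * rayQ j n : ℚ) : ℚ_[2]) := by
      rw [← ha n hn, Rat.cast_intCast]
    have e2 : (b n : ℚ_[2]) = ((rayMult j n * P n : ℚ) : ℚ_[2]) := by
      rw [← hb n hn, Rat.cast_intCast]
    rw [e1, e2, hA2 n hn]; push_cast; ring
  have hnorm : ∀ n : ℕ, 1 ≤ n →
      ‖(a n : ℚ_[2]) * xi + b n‖
        = (2 : ℝ) ^ (-(4 * (2 * j + 1) * (n : ℤ) + 2 - ((Nat.digits 2 (j * n)).sum : ℤ)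
              - ((Nat.digits 2 ((j + 1) * n)).sum : ℤ))) := by
    intro n hn
    rw [hform n hn, norm_mul, norm_ratCast_eq _ (rayMult_ne_zero j n), padicValRat_two_rayMult, norm_J2,
      ← zpow_add₀ (by norm_num : (2 : ℝ) ≠ 0)]
    congr 1
    have := rayExponent_eq j n
    push_cast at this ⊢
    linarith
  -- the index threshold: δ = 4W log 2 − τ > 0, and n ≥ N ⇒ j(j+1) n² < e^{δ n}
  set δ : ℝ := 4 * (2 * j + 1) * log 2 - τ with hδ
  have hδ0 : 0 < δ := by rw [hδ]; linarith
  obtain ⟨N, hN⟩ := exists_nat_gt (6 * ((j : ℝ) * (j + 1)) / δ ^ 3)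
  obtain ⟨N', hN'⟩ := exists_nat_gt (2 * log 2 / (τ' - 4 * (2 * j + 1) * log 2))
  refine ⟨max (max (max n₀ 1) N) N', ?_⟩
  set n₁ : ℕ := max (max (max n₀ 1) N) N' with hn₁
  have hn₁0 : n₀ ≤ n₁ := le_trans (le_trans (le_max_left _ _) (le_max_left _ _)) (le_max_left _ _)
  have hn₁1 : 1 ≤ n₁ := le_trans (le_trans (le_max_right _ _) (le_max_left _ _)) (le_max_left _ _)
  have hn₁N : N ≤ n₁ := le_trans (le_max_right _ _) (le_max_left _ _)
  have hn₁N' : N' ≤ n₁ := le_max_right _ _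
  have hlog2 : (0 : ℝ) < log 2 := log_pos one_lt_two
  -- apply the general measure theorem
  have key := measure_of_two_sided_forms (p := 2) xi a b (h := hg) (τ := τ)
    (τ' := τ') (n₀ := n₁) hg0 hτ1 (by linarith) ?_ ?_ ?_
  · intro r
    exact key r
  · -- growth
    intro n hn
    have hn0 : n₀ ≤ n := hn₁0.trans hn
    have hn1 : 1 ≤ n := hn₁1.trans hn
    have hg' := hGP n hn0
    have e1 : ((a n).natAbs : ℝ) = |((rayMult j n * rayQ j n : ℚ) : ℝ)| := by
      rw [Nat.cast_natAbs, Int.cast_abs, ← ha n hn1, Rat.cast_intCast]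
    have e2 : ((b n).natAbs : ℝ) = |((rayMult j n * P n : ℚ) : ℝ)| := by
      rw [Nat.cast_natAbs, Int.cast_abs, ← hb n hn1, Rat.cast_intCast]
    rw [e1, e2]
    push_cast at hg' ⊢
    exact hg'
  · -- upper bound: exact norm < e^{-τ n}
    intro n hn
    have hn1 : 1 ≤ n := hn₁1.trans hn
    have hnN : N ≤ n := hn₁N.trans hn
    rw [hnorm n hn1]
    -- 2^{-(4Wn+2)+s+s'} ≤ 2^{-4Wn} · j(j+1) n²
    have hs1 := two_pow_digitSum_le (j * n) (Nat.mul_ne_zero (by omega) (by omega))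
    have hs2 := two_pow_digitSum_le ((j + 1) * n) (Nat.mul_ne_zero (by omega) (by omega))
    have hs1' : (2 : ℝ) ^ ((Nat.digits 2 (j * n)).sum : ℤ) ≤ 2 * ((j : ℝ) * n) := by
      rw [zpow_natCast]; exact_mod_cast hs1
    have hs2' : (2 : ℝ) ^ ((Nat.digits 2 ((j + 1) * n)).sum : ℤ) ≤ 2 * (((j : ℝ) + 1) * n) := by
      rw [zpow_natCast]; exact_mod_cast hs2
    have hsplit : (2 : ℝ) ^ (-(4 * (2 * j + 1) * (n : ℤ) + 2 - ((Nat.digits 2 (j * n)).sum : ℤ)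
              - ((Nat.digits 2 ((j + 1) * n)).sum : ℤ)))
          = (2 : ℝ) ^ (-(4 * (2 * j + 1) * (n : ℤ))) * (1 / 4) *
              ((2 : ℝ) ^ ((Nat.digits 2 (j * n)).sum : ℤ) * (2 : ℝ) ^ ((Nat.digits 2 ((j + 1) * n)).sum : ℤ)) := by
      rw [show -(4 * (2 * j + 1) * (n : ℤ) + 2 - ((Nat.digits 2 (j * n)).sum : ℤ)
              - ((Nat.digits 2 ((j + 1) * n)).sum : ℤ))
            = -(4 * (2 * j + 1) * (n : ℤ)) + (-2) + (((Nat.digits 2 (j * n)).sum : ℤ)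
              + ((Nat.digits 2 ((j + 1) * n)).sum : ℤ)) by ring,
        zpow_add₀ (by norm_num : (2:ℝ) ≠ 0), zpow_add₀ (by norm_num : (2:ℝ) ≠ 0),
        zpow_add₀ (by norm_num : (2:ℝ) ≠ 0)]
      norm_num
    have hpow_pos : (0 : ℝ) < (2 : ℝ) ^ (-(4 * (2 * j + 1) * (n : ℤ))) := zpow_pos (by norm_num) _
    have hup1 : (2 : ℝ) ^ (-(4 * (2 * j + 1) * (n : ℤ) + 2 - ((Nat.digits 2 (j * n)).sum : ℤ)
              - ((Nat.digits 2 ((j + 1) * n)).sum : ℤ)))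
          ≤ (2 : ℝ) ^ (-(4 * (2 * j + 1) * (n : ℤ))) * (((j : ℝ) * (j + 1)) * (n : ℝ) ^ 2) := by
      rw [hsplit, mul_assoc]
      refine mul_le_mul_of_nonneg_left ?_ hpow_pos.le
      have h1 : (0:ℝ) ≤ (2 : ℝ) ^ ((Nat.digits 2 (j * n)).sum : ℤ) := zpow_nonneg (by norm_num) _
      have h2 : (0:ℝ) ≤ 2 * (((j : ℝ) + 1) * n) := by positivity
      calc (1 / 4 : ℝ) * ((2 : ℝ) ^ ((Nat.digits 2 (j * n)).sum : ℤ) * (2 : ℝ) ^ ((Nat.digits 2 ((j + 1) * n)).sum : ℤ))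
          ≤ (1 / 4) * ((2 * ((j : ℝ) * n)) * (2 * (((j : ℝ) + 1) * n))) := by
            gcongr
        _ = ((j : ℝ) * (j + 1)) * (n : ℝ) ^ 2 := by ring
    -- 2^{-4Wn} = e^{-4W log2 n} and j(j+1)n² < e^{δ n}
    have h2pow : (2 : ℝ) ^ (-(4 * (2 * j + 1) * (n : ℤ))) = exp (-(4 * (2 * j + 1) * log 2 * n)) := by
      rw [← rpow_intCast, rpow_def_of_pos (by norm_num : (0:ℝ) < 2)]; congr 1; push_cast; ring
    have hNn : 6 * ((j : ℝ) * (j + 1)) / δ ^ 3 < n := by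
      calc 6 * ((j : ℝ) * (j + 1)) / δ ^ 3 < (N : ℝ) := hN
        _ ≤ n := by exact_mod_cast hnN
    have hpoly : ((j : ℝ) * (j + 1)) * (n : ℝ) ^ 2 < exp (δ * n) := by
      have hδn : 0 ≤ δ * n := by positivity
      have h3 := pow_div_factorial_le_exp (x := δ * n) hδn 3
      have hn' : (0 : ℝ) < n := by exact_mod_cast (show 0 < n by omega)
      have : ((j : ℝ) * (j + 1)) * (n : ℝ) ^ 2 < (δ * n) ^ 3 / (Nat.factorial 3) := by
        rw [show (Nat.factorial 3 : ℝ) = 6 by norm_num, lt_div_iff₀ (by norm_num : (0:ℝ) < 6)]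
        have hδ3 : 0 < δ ^ 3 := by positivity
        have h5 := (div_lt_iff₀ hδ3).mp hNn
        have h4 : 6 * ((j : ℝ) * (j + 1)) * (n : ℝ) ^ 2 < (n : ℝ) * δ ^ 3 * (n : ℝ) ^ 2 :=
          mul_lt_mul_of_pos_right h5 (by positivity)
        calc (j : ℝ) * (j + 1) * (n : ℝ) ^ 2 * 6 = 6 * ((j : ℝ) * (j + 1)) * (n : ℝ) ^ 2 := by ring
          _ < (n : ℝ) * δ ^ 3 * (n : ℝ) ^ 2 := h4
          _ = (δ * n) ^ 3 := by ring
      exact this.trans_le h3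
    calc (2 : ℝ) ^ (-(4 * (2 * j + 1) * (n : ℤ) + 2 - ((Nat.digits 2 (j * n)).sum : ℤ)
              - ((Nat.digits 2 ((j + 1) * n)).sum : ℤ)))
        ≤ (2 : ℝ) ^ (-(4 * (2 * j + 1) * (n : ℤ))) * (((j : ℝ) * (j + 1)) * (n : ℝ) ^ 2) := hup1
      _ < exp (-(4 * (2 * j + 1) * log 2 * n)) * exp (δ * n) := by rw [h2pow]; gcongr
      _ = exp (-(τ * n)) := by rw [← exp_add]; congr 1; rw [hδ]; ring
  · -- lower bound: exact norm ≥ 2^{-(4Wn+2)} ≥ e^{-τ' n} as soon as (τ' − 4W log 2)·n ≥ 2 log 2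
    intro n hn
    have hn1 : 1 ≤ n := hn₁1.trans hn
    have hnN' : N' ≤ n := hn₁N'.trans hn
    rw [hnorm n hn1]
    have hgap' : 0 < τ' - 4 * (2 * j + 1) * log 2 := by linarith
    have hnr : 2 * log 2 / (τ' - 4 * (2 * j + 1) * log 2) < n :=
      hN'.trans_le (by exact_mod_cast hnN')
    have hlin : 4 * (2 * j + 1) * log 2 * n + 2 * log 2 ≤ τ' * n := by
      have := (div_lt_iff₀ hgap').mp hnr
      nlinarith
    calc exp (-(τ' * n)) ≤ exp (-(4 * (2 * j + 1) * log 2 * n + 2 * log 2)) := exp_le_exp.mpr (by linarith)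
      _ = (2 : ℝ) ^ (-(4 * (2 * j + 1) * (n : ℤ)) - 2) := by
          rw [← rpow_intCast, rpow_def_of_pos (by norm_num : (0:ℝ) < 2)]; congr 1; push_cast; ring
      _ ≤ (2 : ℝ) ^ (-(4 * (2 * j + 1) * (n : ℤ) + 2 - ((Nat.digits 2 (j * n)).sum : ℤ)
              - ((Nat.digits 2 ((j + 1) * n)).sum : ℤ))) := by
          apply zpow_le_zpow_right₀ (by norm_num : (1:ℝ) ≤ 2)
          have h1 : (0 : ℤ) ≤ ((Nat.digits 2 (j * n)).sum : ℤ) := by positivity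
          have h2 : (0 : ℤ) ≤ ((Nat.digits 2 ((j + 1) * n)).sum : ℤ) := by positivity
          linarith

/-- **The ray chain, assembled.** Given the transfer law, integrality of the cleared forms and their growth rate
`h_g`, every `τ` with `h_g < τ < 4W log 2` yields the explicit 2-adic irrationality measure
`‖ξ − u/v‖₂ ≥ C · max(|u|,v)^{−τ'/(τ − h_g)}` for ALL rationals `u/v` and every `τ' > 4W log 2`. -/
theorem ray_measure (hT : TwoAdicTransfer) {j : ℕ} (hj : 1 ≤ j) (hI : RayIntegrality j)
    {hg : ℝ} {n₀ : ℕ} (hG : RayGrowth j hg n₀) (hg0 : 0 ≤ hg) {τ τ' : ℝ} (hτ1 : hg < τ)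
    (hτ2 : τ < 4 * (2 * j + 1) * log 2) (hτ' : 4 * (2 * j + 1) * log 2 < τ') :
    ∃ n₁ : ℕ, ∀ r : ℚ,
      exp (-(τ' * (n₁ + 1))) * (max (r.num.natAbs : ℝ) r.den) ^ (-(τ' / (τ - hg)))
        ≤ ‖xi - ((r : ℚ) : ℚ_[2])‖ := by
  -- abbreviations
  set W : ℕ := 2 * j + 1 with hW
  have hW1 : (1 : ℝ) ≤ W := by rw [hW]; push_cast; linarith [(show (1:ℝ) ≤ j by exact_mod_cast hj)]
  -- box conditions on the ray, for n ≥ 1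
  have box : ∀ n : ℕ, 1 ≤ n →
      n ≤ n + (j + 1) * n ∧ j * n ≤ (j + 1) * n + n ∧ n ≤ n + n ∧ (j + 1) * n ≤ n + j * n ∧
        n + 1 ≤ j * n + n := by
    intro n hn
    refine ⟨by omega, by nlinarith, by omega, by nlinarith, ?_⟩
    have : 1 ≤ j * n := Nat.one_le_iff_ne_zero.mpr (Nat.mul_ne_zero (by omega) (by omega))
    omega
  -- the transfer data P_n (defined for all n, meaningful for n ≥ 1)
  have hP : ∀ n : ℕ, ∃ P : ℚ, 1 ≤ n →
      Jsym n (j * n) n ((j + 1) * n) n = (rayQ j n : ℝ) * catalanConstant + (P : ℝ) ∧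
        J2 n (j * n) n ((j + 1) * n) n = ((P : ℚ) : ℚ_[2]) + xi * ((rayQ j n : ℚ) : ℚ_[2]) := by
    intro n
    by_cases hn : 1 ≤ n
    · obtain ⟨h1, h2, h3, h4, h5⟩ := box n hn
      obtain ⟨P, hP1, hP2⟩ := hT n (j * n) n ((j + 1) * n) n h1 h2 h3 h4 h5
      exact ⟨P, fun _ => ⟨hP1, hP2⟩⟩
    · exact ⟨0, fun h => absurd h hn⟩
  choose P hP using hP
  have h1le : ∀ n : ℕ, max n₀ 1 ≤ n → 1 ≤ n := fun n hn => (le_max_right _ _).trans hn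
  exact ray_measure_intrinsic hj P (fun n hn => (hP n hn).2) (fun n hn => hI n hn (P n) (hP n hn).1)
    (n₀ := max n₀ 1) (fun n hn => hG n ((le_max_left _ _).trans hn) (P n) (hP n (h1le n hn)).1) hg0 hτ1 hτ2 hτ'

/-- Corollary: under the same hypotheses `ξ` is not a rational number (a 2-adic re-derivation, through the Catalan
box family, of the KNOWN irrationality of `ζ₂(2)` [Calegari 2005] — conditional here on the three named inputs). -/
theorem xi_not_ratCast_of_ray (hT : TwoAdicTransfer) {j : ℕ} (hj : 1 ≤ j) (hI : RayIntegrality j)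
    {hg : ℝ} {n₀ : ℕ} (hG : RayGrowth j hg n₀) (hg0 : 0 ≤ hg) (hτ : hg < 4 * (2 * j + 1) * log 2) :
    ∀ r : ℚ, xi ≠ ((r : ℚ) : ℚ_[2]) := by
  intro r hr
  obtain ⟨τ, hτ1, hτ2⟩ := exists_between hτ
  obtain ⟨n₁, hmeas⟩ := ray_measure hT hj hI hG hg0 hτ1 hτ2 (lt_add_one _)
  have h := hmeas r
  rw [hr, sub_self, norm_zero] at h
  have hpos : (0 : ℝ) < exp (-((4 * (2 * j + 1) * log 2 + 1) * (n₁ + 1))) *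
      (max (r.num.natAbs : ℝ) r.den) ^ (-((4 * (2 * j + 1) * log 2 + 1) / (τ - hg))) := by
    have hH : (0 : ℝ) < max (r.num.natAbs : ℝ) r.den :=
      lt_of_lt_of_le (by exact_mod_cast r.den_pos) (le_max_right _ _)
    positivity
  linarith

end Summit.KontsevichZagierPeriods.Zeta5Search.CatalanTwoAdicSeries
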